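import Summits.CriticalPhenomena.PercolationContinuityZ3.Theorems.PercBoundarySqueezeFreeBoxFatClusterMassGiantPolyLRO
import Summits.CriticalPhenomena.PercolationContinuityZ3.Theorems.PercNonProliferationFreeBoxPowerSavingPairSumShift
import Summits.CriticalPhenomena.PercolationContinuityZ3.Theorems.PercBoundarySqueezeFreeBoxFatClusterMassJumpReduction
import Literature.Probability.Percolation.RSW

/-!
# Crux `PercBoundarySqueeze.FreeBoxFatClusterMass` (stmt-CriticalPhenomena-6982): the registered stub B_∞ is
# conjunct-strength modulo box long-range order at ONE polynomial scale `α < 2`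

Helper file of the lead prover's line `registered` (skeleton v3.1, stub `stub_giantFatMass_jump`), landed
`--supports stmt-CriticalPhenomena-6982`; sorry-free.  B_∞ = "at `p_c(ℤ³)` the fat in-box pieces
(`≥ ⌊R^{3/2}⌋` vertices joined inside `Λ_R`) OF THE INFINITE CLUSTER carry `≤ C R^{3-δ}` expected mass".
`percolationContinuityZ3_of_polyScaleLRO_of_giantFatMass` (p149769) needed box long-range order at EVERY
scale `α > 1` (`PercFiniteBoxLRO.PolyScaleLROOfTheta`, stmt-0858) because it only counted the central core
`Λ_n ⊆ Λ_{⌈n^α⌉}`.  Tiling the box by translates removes this: **long-range order at a single scale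
`1 ≤ α < 2` in a jump world already contradicts B_∞.**

* `percolationContinuityZ3_of_scaleLRO_of_giantFatMass` : `(∃ α ∈ [1,2), ScaleLRO(α)) → B_∞ → θ(p_c) = 0`,
  where `ScaleLRO(α)` = "for percolating `p`: `∃ ρ > 0, ∀ n ≥ 1, ∀ x, y ∈ Λ_n, P_p(x ↔ y in Λ_{⌈n^α⌉}) ≥ ρ`"
  (the body of `PolyScaleLROOfTheta` at one `α`);
* `scaleLRO_of_polyScaleLRO` : 0858 gives `ScaleLRO(3/2)`, so p149769 is a corollary
  (`percolationContinuityZ3_of_polyScaleLRO_of_giantFatMass'`).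

Proof.  Suppose `θ = θ(p_c) > 0`; get `ρ` from `ScaleLRO(α)` at `p_c`.  For `n` large put `m = ⌈n^α⌉`,
`R = 2m`.  For EVERY `x ∈ Λ_m` and `y' ∈ Λ_n`: `x + Λ_m ⊆ Λ_R`, so by monotonicity and translation invariance
`P(x ↔ x + y' in Λ_R) ≥ P(x ↔ x + y' in x + Λ_m) = P(0 ↔ y' in Λ_m) ≥ ρ`.  Reverse Markov over the `|Λ_n|`
partners `x + Λ_n` with `t = ρ|Λ_n|/2` gives `P(#partners ≥ t) ≥ ρ/2`, and `t ≥ ⌊R^{3/2}⌋` as soon as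
`(2⌈n^α⌉)³ ≤ (ρ(2n+1)³/2)²`, i.e. eventually iff `3α < 6`.  The jump split and the qualitative finite-cluster
tail (`GiantLRO.finiteTail_eventually_le`) give `P(fat_R(x) ∧ |C(x)| = ∞) ≥ ρ/4` for all `x ∈ Λ_m`; summing,
`(ρ/4)(2m+1)³ ≤ C (2m)^{3-δ}`, false for large `m`.  (Cerf, Ann. Probab. 43 (2015) Thm 1.3 proves `ScaleLRO(16)`
for `d = 3` from `θ(p) > 0` alone; `α < 2` is what the volume threshold `R^{3/2}` demands.)
-/

noncomputable section

namespace Summit.CriticalPhenomena.PercolationContinuityZ3.FreeBoxFatClusterMassLine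

open MeasureTheory Filter Topology
open Literature.Probability.Percolation Literature.Probability.LatticeModels
open scoped Classical BigOperators

namespace GiantScaleLRO

/-! ### Reverse Markov over an arbitrary finite set of partners -/

/-- **Reverse Markov** (every `p`, `t ≥ 0`, any finite partner set `A`):
`Σ_{y ∈ A} P(x ↔ y in Λ_R) ≤ t + |A| · P(t ≤ #{y ∈ A : x ↔ y in Λ_R})`
(pointwise `M ≤ t + |A| 1{M ≥ t}` for `M = #{y ∈ A : x ↔ y in Λ_R} ≤ |A|`, then integrate). [folklore] -/
theorem sum_real_le (p : unitInterval) (A : Finset (Site 3)) (R : ℕ) (x : Site 3) {t : ℝ} (ht : 0 ≤ t) :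
    ∑ y ∈ A, (bondPercolation (zdGraph 3) p).real (openConnIn (↑(box 3 R) : Set (Site 3)) x y) ≤
      t + (A.card : ℝ) * (bondPercolation (zdGraph 3) p).real
        {ω | t ≤ ((A.filter fun y => ω ∈ openConnIn (↑(box 3 R) : Set (Site 3)) x y).card : ℝ)} := by
  set μ := bondPercolation (zdGraph 3) p with hμ
  set E : Site 3 → Set (BondConfig (Site 3)) := fun y => openConnIn (↑(box 3 R) : Set (Site 3)) x y
    with hE
  set M : BondConfig (Site 3) → ℝ := fun ω => ∑ y ∈ A, (E y).indicator (1 : BondConfig (Site 3) → ℝ) ω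
    with hM
  set G : Set (BondConfig (Site 3)) :=
    {ω | t ≤ ((A.filter fun y => ω ∈ openConnIn (↑(box 3 R) : Set (Site 3)) x y).card : ℝ)} with hG
  have hEm : ∀ y, MeasurableSet (E y) := fun y => DCT16.measurableSet_openConnIn _ x y
  have hMm : Measurable M :=
    Finset.measurable_sum _ fun y _ => measurable_const.indicator (hEm y)
  have hMcard : ∀ ω, M ω =
      ((A.filter fun y => ω ∈ openConnIn (↑(box 3 R) : Set (Site 3)) x y).card : ℝ) := by
    intro ω
    rw [hM, Finset.natCast_card_filter]
    refine Finset.sum_congr rfl fun y _ => ?_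
    simp only [Set.indicator_apply, Pi.one_apply, hE]
  have hGeq : G = {ω | t ≤ M ω} := by
    ext ω; simp only [hG, Set.mem_setOf_eq, hMcard]
  have hGm : MeasurableSet G := by
    rw [hGeq]; exact measurableSet_le measurable_const hMm
  have hMle : ∀ ω, M ω ≤ (A.card : ℝ) := by
    intro ω
    rw [hMcard]
    exact_mod_cast Finset.card_filter_le _ _
  have hpt : ∀ ω, M ω ≤ t + (A.card : ℝ) * G.indicator (1 : BondConfig (Site 3) → ℝ) ω := by
    intro ω
    by_cases hω : ω ∈ G
    · rw [Set.indicator_of_mem hω, Pi.one_apply, mul_one]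
      linarith [hMle ω]
    · rw [Set.indicator_of_notMem hω, mul_zero, add_zero]
      have : ¬ t ≤ M ω := by rwa [hGeq] at hω
      exact (not_le.1 this).le
  have hint1 : ∀ y, Integrable (fun ω => (E y).indicator (1 : BondConfig (Site 3) → ℝ) ω) μ := fun y =>
    (integrable_const (1 : ℝ)).indicator (hEm y)
  have hintM : Integrable M μ := integrable_finsetSum _ fun y _ => hint1 y
  have hintG : Integrable (fun ω => G.indicator (1 : BondConfig (Site 3) → ℝ) ω) μ :=
    (integrable_const (1 : ℝ)).indicator hGm
  have hintR : Integrable (fun ω => t + (A.card : ℝ) * G.indicator (1 : BondConfig (Site 3) → ℝ) ω) μ :=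
    (integrable_const t).add (hintG.const_mul _)
  have hmono : ∫ ω, M ω ∂μ ≤ ∫ ω, (t + (A.card : ℝ) * G.indicator (1 : BondConfig (Site 3) → ℝ) ω) ∂μ :=
    integral_mono hintM hintR hpt
  have hL : ∫ ω, M ω ∂μ = ∑ y ∈ A, μ.real (E y) := by
    rw [hM, integral_finsetSum _ fun y _ => hint1 y]
    exact Finset.sum_congr rfl fun y _ => integral_indicator_one (hEm y)
  have hR : ∫ ω, (t + (A.card : ℝ) * G.indicator (1 : BondConfig (Site 3) → ℝ) ω) ∂μ =
      t + (A.card : ℝ) * μ.real G := by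
    rw [integral_add (integrable_const t) (hintG.const_mul _), integral_const_mul, integral_const,
      integral_indicator_one hGm, smul_eq_mul, probReal_univ, one_mul]
  rw [hL, hR] at hmono
  exact hmono

/-- **Many partners make a fat piece** (pointwise, any partner set `A`): if
`⌊R^{3/2}⌋ ≤ t ≤ #{y ∈ A : x ↔ y in Λ_R}` then some finset `T` with `Nat.sqrt (R^3) ≤ #T` is joined to `x`
inside `Λ_R`. [folklore] -/
theorem fat_of_count (A : Finset (Site 3)) {R : ℕ} {t : ℝ} (ht : ((Nat.sqrt (R ^ 3) : ℕ) : ℝ) ≤ t)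
    {x : Site 3} {ω : BondConfig (Site 3)}
    (h : t ≤ ((A.filter fun y => ω ∈ openConnIn (↑(box 3 R) : Set (Site 3)) x y).card : ℝ)) :
    ∃ T : Finset (Site 3), Nat.sqrt (R ^ 3) ≤ T.card ∧
      ∀ y ∈ T, ω ∈ openConnIn (↑(box 3 R) : Set (Site 3)) x y := by
  refine ⟨A.filter fun y => ω ∈ openConnIn (↑(box 3 R) : Set (Site 3)) x y, ?_,
    fun y hy => (Finset.mem_filter.1 hy).2⟩
  exact_mod_cast ht.trans h

/-! ### Tiling: translated boxes and translated connections -/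

/-- The translate of `Λ_m` by a point of `Λ_m` lies in `Λ_{2m}`. [folklore] -/
theorem image_add_box_subset {m : ℕ} {x : Site 3} (hx : x ∈ box 3 m) :
    (fun w : Site 3 => w + x) '' (↑(box 3 m) : Set (Site 3)) ⊆ (↑(box 3 (2 * m)) : Set (Site 3)) := by
  rintro w ⟨u, hu, rfl⟩
  rw [Finset.mem_coe, mem_box] at hu ⊢
  rw [mem_box] at hx
  intro i
  have h1 := hu i
  have h2 := hx i
  simp only [Pi.add_apply]
  push_cast
  omega

/-- **Translated long-range-order term**: for `x ∈ Λ_m` and any `y'`,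
`P(0 ↔ y' in Λ_m) ≤ P(x ↔ y' + x in Λ_{2m})` (translation invariance, Grimmett 1999 §1.6, then
monotonicity of `{· ↔ · in S}` in `S`, as `x + Λ_m ⊆ Λ_{2m}`). [folklore] -/
theorem real_openConnIn_box_le_translate (p : unitInterval) {m : ℕ} {x : Site 3} (hx : x ∈ box 3 m)
    (y' : Site 3) :
    (bondPercolation (zdGraph 3) p).real (openConnIn (↑(box 3 m) : Set (Site 3)) 0 y') ≤
      (bondPercolation (zdGraph 3) p).real (openConnIn (↑(box 3 (2 * m)) : Set (Site 3)) x (y' + x)) := by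
  have h := FreeBoxPowerSavingLine.PairSumShift.real_openConnIn_add_box p m x 0 y'
  rw [zero_add] at h
  rw [← h]
  exact measureReal_mono (openConnIn_mono (image_add_box_subset hx) _ _)

/-! ### Arithmetic of the scales -/

/-- Eventually in `n` (with `m = ⌈n^α⌉`, `1 ≤ α < 2`): `n ≥ 1`, `N ≤ 2m`, `(2m)³ ≤ (ρ(2n+1)³/2)²` and
`max C 0 · (2m)^{3-δ} < (ρ/4)(2m+1)³`. [folklore] -/
theorem eventually_large (N : ℕ) {α ρ δ : ℝ} (hα1 : 1 ≤ α) (hα2 : α < 2) (hρ : 0 < ρ) (hδ : 0 < δ)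
    (C : ℝ) :
    ∃ n : ℕ, 1 ≤ n ∧ N ≤ 2 * ⌈(n : ℝ) ^ α⌉₊ ∧
      (((2 * ⌈(n : ℝ) ^ α⌉₊ : ℕ) : ℝ)) ^ 3 ≤ (ρ * (2 * (n : ℝ) + 1) ^ 3 / 2) ^ 2 ∧
      max C 0 * (((2 * ⌈(n : ℝ) ^ α⌉₊ : ℕ) : ℝ)) ^ ((3 : ℝ) - δ) <
        ρ / 4 * (2 * ((⌈(n : ℝ) ^ α⌉₊ : ℕ) : ℝ) + 1) ^ 3 := by
  have hnat : Tendsto (fun n : ℕ => (n : ℝ)) atTop atTop := tendsto_natCast_atTop_atTop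
  have h1 : ∀ᶠ n : ℕ in atTop, 1 ≤ n := eventually_ge_atTop 1
  -- (b) `N ≤ n ≤ ⌈n^α⌉ ≤ 2⌈n^α⌉`
  have h2 : ∀ᶠ n : ℕ in atTop, N ≤ 2 * ⌈(n : ℝ) ^ α⌉₊ := by
    filter_upwards [eventually_ge_atTop N, h1] with n hn hn1
    have := (GiantPolyLRO.ceil_rpow_bounds hn1 hα1).2
    omega
  -- (c) `(2⌈n^α⌉)³ ≤ 64 n^{3α} ≤ 16 ρ² n⁶ ≤ (ρ(2n+1)³/2)²`, eventually (`6 - 3α > 0`)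
  have h3 : ∀ᶠ n : ℕ in atTop,
      (((2 * ⌈(n : ℝ) ^ α⌉₊ : ℕ) : ℝ)) ^ 3 ≤ (ρ * (2 * (n : ℝ) + 1) ^ 3 / 2) ^ 2 := by
    have hgap : 0 < 6 - 3 * α := by linarith
    have hev : ∀ᶠ n : ℕ in atTop, 4 / ρ ^ 2 ≤ (n : ℝ) ^ (6 - 3 * α) := by
      have : Tendsto (fun n : ℕ => (n : ℝ) ^ (6 - 3 * α)) atTop atTop :=
        (tendsto_rpow_atTop hgap).comp hnat
      exact this.eventually_ge_atTop _
    filter_upwards [hev, h1] with n hn hn1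
    have hn1' : (1 : ℝ) ≤ n := by exact_mod_cast hn1
    have hn0 : (0 : ℝ) < n := by linarith
    obtain ⟨hceil, -⟩ := GiantPolyLRO.ceil_rpow_bounds hn1 hα1
    have hnα0 : (0 : ℝ) ≤ (n : ℝ) ^ α := Real.rpow_nonneg hn0.le _
    have hρ2 : 0 < ρ ^ 2 := by positivity
    -- (2⌈n^α⌉)³ ≤ (4 n^α)³ = 64 (n^α)³
    have hA : (((2 * ⌈(n : ℝ) ^ α⌉₊ : ℕ) : ℝ)) ^ 3 ≤ (4 * (n : ℝ) ^ α) ^ 3 := by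
      have h2c : (((2 * ⌈(n : ℝ) ^ α⌉₊ : ℕ) : ℝ)) ≤ 4 * (n : ℝ) ^ α := by push_cast; linarith
      exact pow_le_pow_left₀ (by positivity) h2c 3
    -- (n^α)³ = n^{3α} and n⁶ = n^{3α} · n^{6-3α}
    have hpow3 : ((n : ℝ) ^ α) ^ 3 = (n : ℝ) ^ (3 * α) := by
      rw [← Real.rpow_natCast, ← Real.rpow_mul hn0.le]; ring_nf
    have hn6 : (n : ℝ) ^ (6 : ℕ) = (n : ℝ) ^ (3 * α) * (n : ℝ) ^ (6 - 3 * α) := by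
      rw [← Real.rpow_add hn0, show 3 * α + (6 - 3 * α) = ((6 : ℕ) : ℝ) by push_cast; ring,
        Real.rpow_natCast]
    have hn3α : 0 ≤ (n : ℝ) ^ (3 * α) := Real.rpow_nonneg hn0.le _
    -- 64 n^{3α} ≤ 16 ρ² n⁶
    have hB : 64 * (n : ℝ) ^ (3 * α) ≤ 16 * ρ ^ 2 * (n : ℝ) ^ (6 : ℕ) := by
      rw [hn6]
      have h4 : 4 ≤ ρ ^ 2 * (n : ℝ) ^ (6 - 3 * α) := by
        rw [div_le_iff₀ hρ2] at hn; linarith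
      calc 64 * (n : ℝ) ^ (3 * α) = 16 * (n : ℝ) ^ (3 * α) * 4 := by ring
        _ ≤ 16 * (n : ℝ) ^ (3 * α) * (ρ ^ 2 * (n : ℝ) ^ (6 - 3 * α)) := by gcongr
        _ = 16 * ρ ^ 2 * ((n : ℝ) ^ (3 * α) * (n : ℝ) ^ (6 - 3 * α)) := by ring
    -- 16 ρ² n⁶ ≤ (ρ (2n+1)³ / 2)²
    have h8 : 8 * (n : ℝ) ^ 3 ≤ (2 * (n : ℝ) + 1) ^ 3 := by nlinarith
    have hC : 16 * ρ ^ 2 * (n : ℝ) ^ (6 : ℕ) ≤ (ρ * (2 * (n : ℝ) + 1) ^ 3 / 2) ^ 2 := by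
      have h8' : 0 ≤ 8 * (n : ℝ) ^ 3 := by positivity
      calc 16 * ρ ^ 2 * (n : ℝ) ^ (6 : ℕ) = (ρ * (8 * (n : ℝ) ^ 3) / 2) ^ 2 := by ring
        _ ≤ (ρ * (2 * (n : ℝ) + 1) ^ 3 / 2) ^ 2 := by gcongr
    calc (((2 * ⌈(n : ℝ) ^ α⌉₊ : ℕ) : ℝ)) ^ 3 ≤ (4 * (n : ℝ) ^ α) ^ 3 := hA
      _ = 64 * (n : ℝ) ^ (3 * α) := by rw [mul_pow, hpow3]; norm_num
      _ ≤ 16 * ρ ^ 2 * (n : ℝ) ^ (6 : ℕ) := hB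
      _ ≤ _ := hC
  -- (d) `max C 0 · M^{3-δ} < (ρ/4) M³ ≤ (ρ/4)(M+1)³` with `M = 2⌈n^α⌉ ≥ 2n`, eventually (`M^δ → ∞`)
  have h4 : ∀ᶠ n : ℕ in atTop,
      max C 0 * (((2 * ⌈(n : ℝ) ^ α⌉₊ : ℕ) : ℝ)) ^ ((3 : ℝ) - δ) <
        ρ / 4 * (2 * ((⌈(n : ℝ) ^ α⌉₊ : ℕ) : ℝ) + 1) ^ 3 := by
    set A : ℝ := max C 0 with hA
    have hA0 : 0 ≤ A := le_max_right _ _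
    have hev : ∀ᶠ n : ℕ in atTop, 4 * A / ρ + 1 ≤ (n : ℝ) ^ δ := by
      have : Tendsto (fun n : ℕ => (n : ℝ) ^ δ) atTop atTop := (tendsto_rpow_atTop hδ).comp hnat
      exact this.eventually_ge_atTop _
    filter_upwards [hev, h1] with n hn hn1
    have hn1' : (1 : ℝ) ≤ n := by exact_mod_cast hn1
    have hn0 : (0 : ℝ) < n := by linarith
    obtain ⟨-, hnc⟩ := GiantPolyLRO.ceil_rpow_bounds hn1 hα1
    set M : ℝ := (((2 * ⌈(n : ℝ) ^ α⌉₊ : ℕ) : ℝ)) with hM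
    have hMn : (n : ℝ) ≤ M := by
      rw [hM]; push_cast
      have : (n : ℝ) ≤ ((⌈(n : ℝ) ^ α⌉₊ : ℕ) : ℝ) := by exact_mod_cast hnc
      linarith
    have hM0 : 0 < M := lt_of_lt_of_le hn0 hMn
    -- `M^δ ≥ n^δ > 4A/ρ`
    have hMδ : 4 * A / ρ < M ^ δ := by
      have : (n : ℝ) ^ δ ≤ M ^ δ := Real.rpow_le_rpow hn0.le hMn hδ.le
      linarith
    have hAM : A < ρ / 4 * M ^ δ := by
      have h' : 4 * A / ρ < M ^ δ := hMδ
      rw [div_lt_iff₀ hρ] at h'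
      linarith
    have hsplit : M ^ (3 : ℕ) = M ^ ((3 : ℝ) - δ) * M ^ δ := by
      rw [← Real.rpow_add hM0, show (3 : ℝ) - δ + δ = ((3 : ℕ) : ℝ) by push_cast; ring, Real.rpow_natCast]
    have hMd : 0 < M ^ ((3 : ℝ) - δ) := Real.rpow_pos_of_pos hM0 _
    have hlt : A * M ^ ((3 : ℝ) - δ) < ρ / 4 * M ^ (3 : ℕ) := by
      calc A * M ^ ((3 : ℝ) - δ) < ρ / 4 * M ^ δ * M ^ ((3 : ℝ) - δ) := mul_lt_mul_of_pos_right hAM hMd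
        _ = ρ / 4 * M ^ (3 : ℕ) := by rw [hsplit]; ring
    have hM1 : M ^ (3 : ℕ) ≤ (M + 1) ^ 3 := by
      exact pow_le_pow_left₀ hM0.le (by linarith) 3
    have hMeq : (2 * ((⌈(n : ℝ) ^ α⌉₊ : ℕ) : ℝ) + 1) = M + 1 := by rw [hM]; push_cast; ring
    rw [hMeq]
    calc A * M ^ ((3 : ℝ) - δ) < ρ / 4 * M ^ (3 : ℕ) := hlt
      _ ≤ ρ / 4 * (M + 1) ^ 3 := by gcongr
  obtain ⟨n, hn⟩ := (h1.and (h2.and (h3.and h4))).exists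
  exact ⟨n, hn.1, hn.2.1, hn.2.2.1, hn.2.2.2⟩

end GiantScaleLRO

open GiantLRO GiantScaleLRO

/-- **`ScaleLRO(α)` for ONE `α ∈ [1,2)` and B_∞ give `θ(p_c) = 0`.**  Box long-range order at a single
polynomial scale `α < 2` for percolating `p` (the body of `PercFiniteBoxLRO.PolyScaleLROOfTheta` at one `α`)
together with the registered stub B_∞ (`stub_giantFatMass`, verbatim) already give `PercolationContinuityZ3`
(tiling `Λ_m`, `m = ⌈n^α⌉`, by translates of `Λ_n` inside `Λ_{2m}`).  With `giantFatMass_of_continuity`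
(p149170): B_∞ — hence the crux `FreeBoxFatClusterMass` — is conjunct-EQUIVALENT modulo `∃ α < 2, ScaleLRO(α)`;
Cerf 2015 Thm 1.3 proves `ScaleLRO(16)`. [folklore] -/
theorem percolationContinuityZ3_of_scaleLRO_of_giantFatMass :
    (∃ α : ℝ, 1 ≤ α ∧ α < 2 ∧ ∀ p : unitInterval, 0 < theta (zdGraph 3) 0 p →
      ∃ ρ : ℝ, 0 < ρ ∧ ∀ n : ℕ, 1 ≤ n → ∀ x ∈ box 3 n, ∀ y ∈ box 3 n,
        ρ ≤ (bondPercolation (zdGraph 3) p).real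
          (openConnIn (↑(box 3 ⌈(n : ℝ) ^ α⌉₊) : Set (Site 3)) x y)) →
    (∃ δ C : ℝ, 0 < δ ∧ ∀ R : ℕ, 1 ≤ R →
      ∑ x ∈ box 3 R, (bondPercolation (zdGraph 3) (criticalProbI 3)).real
        {ω | (∃ T : Finset (Site 3), Nat.sqrt (R ^ 3) ≤ T.card ∧
            ∀ y ∈ T, ω ∈ openConnIn (↑(box 3 R) : Set (Site 3)) x y) ∧
          (openCluster ω x).Infinite}
        ≤ C * (R : ℝ) ^ ((3 : ℝ) - δ)) →
      _root_.PercolationContinuityZ3 := by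
  rintro ⟨α, hα1, hα2, hX⟩ hB
  by_contra hcon
  have hθ : 0 < theta (zdGraph 3) (0 : Site 3) (criticalProbI 3) := by
    have h0 : 0 ≤ theta (zdGraph 3) (0 : Site 3) (criticalProbI 3) := measureReal_nonneg
    exact lt_of_le_of_ne h0 (fun h => hcon h.symm)
  set μ := bondPercolation (zdGraph 3) (criticalProbI 3) with hμ
  obtain ⟨ρ, hρ, hLRO⟩ := hX (criticalProbI 3) hθ
  obtain ⟨δ, CB, hδ, hB⟩ := hB
  -- the finite tail below `ρ/4`
  obtain ⟨N, hN⟩ := finiteTail_eventually_le (criticalProbI 3) (by linarith : 0 < ρ / 4)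
  -- the scales `n`, `m = ⌈n^α⌉`, `R = 2m`
  obtain ⟨n, hn1, hNR, hc3, hc4⟩ := GiantScaleLRO.eventually_large N hα1 hα2 hρ hδ CB
  set m : ℕ := ⌈(n : ℝ) ^ α⌉₊ with hm
  set R : ℕ := 2 * m with hR
  have hnm : n ≤ m := (GiantPolyLRO.ceil_rpow_bounds hn1 hα1).2
  have hm1 : 1 ≤ m := hn1.trans hnm
  have hmR : m ≤ R := by omega
  have hR1 : 1 ≤ R := hm1.trans hmR
  have hρR : (0 : ℝ) < R := by exact_mod_cast hR1
  have hcard : ((box 3 n).card : ℝ) = (2 * (n : ℝ) + 1) ^ 3 := by rw [card_box]; push_cast; ring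
  have hcard0 : (0 : ℝ) < ((box 3 n).card : ℝ) := by rw [hcard]; positivity
  have hcardm : ((box 3 m).card : ℝ) = (2 * (m : ℝ) + 1) ^ 3 := by rw [card_box]; push_cast; ring
  set t : ℝ := ρ * ((box 3 n).card : ℝ) / 2 with ht
  have ht0 : 0 ≤ t := by positivity
  -- `⌊R^{3/2}⌋ ≤ t`
  have hsqrt : ((Nat.sqrt (R ^ 3) : ℕ) : ℝ) ≤ t := by
    have h1 : ((Nat.sqrt (R ^ 3) : ℕ) : ℝ) ^ 2 ≤ ((R ^ 3 : ℕ) : ℝ) := by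
      exact_mod_cast Nat.sqrt_le' (R ^ 3)
    have hR3 : ((R ^ 3 : ℕ) : ℝ) = (((2 * ⌈(n : ℝ) ^ α⌉₊ : ℕ) : ℝ)) ^ 3 := by rw [hR, hm]; push_cast; ring
    have h2 : ((R ^ 3 : ℕ) : ℝ) ≤ t ^ 2 := by rw [hR3, ht, hcard]; exact hc3
    exact le_of_pow_le_pow_left₀ two_ne_zero ht0 (h1.trans h2)
  have hR2 : R ^ 2 ≤ R ^ 3 := Nat.pow_le_pow_right hR1 (by norm_num)
  have hRn : R ≤ Nat.sqrt (R ^ 3) := Nat.le_sqrt.2 (by simpa [sq] using hR2)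
  -- per-vertex lower bound on the fat-giant probability, for EVERY `x ∈ Λ_m`
  have hfatinf : ∀ x ∈ box 3 m, ρ / 4 ≤ μ.real
      {ω | (∃ T : Finset (Site 3), Nat.sqrt (R ^ 3) ≤ T.card ∧
          ∀ y ∈ T, ω ∈ openConnIn (↑(box 3 R) : Set (Site 3)) x y) ∧
        (openCluster ω x).Infinite} := by
    intro x hx
    -- the translated partner set `x + Λ_n`
    set A : Finset (Site 3) := (box 3 n).image fun w => w + x with hA
    have hAcard : (A.card : ℝ) = ((box 3 n).card : ℝ) := by
      rw [hA, Finset.card_image_of_injective _ (add_left_injective x)]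
    -- translated LRO, summed over the partners
    have hsum : ρ * ((box 3 n).card : ℝ) ≤
        ∑ y ∈ A, μ.real (openConnIn (↑(box 3 R) : Set (Site 3)) x y) := by
      rw [hA, Finset.sum_image fun a _ b _ h => add_left_injective x h]
      have h := Finset.sum_le_sum fun y' hy' =>
        (hLRO n hn1 0 (zero_mem_box 3 n) y' hy').trans
          (real_openConnIn_box_le_translate (criticalProbI 3) hx y')
      rw [Finset.sum_const, nsmul_eq_mul, mul_comm] at h
      rw [hR]
      exact h
    -- reverse Markov, so `P(G_x) ≥ ρ/2`
    have hrm := GiantScaleLRO.sum_real_le (criticalProbI 3) A R x ht0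
    have hG : ρ / 2 ≤ μ.real
        {ω | t ≤ ((A.filter fun y => ω ∈ openConnIn (↑(box 3 R) : Set (Site 3)) x y).card : ℝ)} := by
      have h' : ((box 3 n).card : ℝ) * (ρ / 2) ≤ ((box 3 n).card : ℝ) * μ.real
          {ω | t ≤ ((A.filter fun y =>
            ω ∈ openConnIn (↑(box 3 R) : Set (Site 3)) x y).card : ℝ)} := by
        have := hsum.trans hrm
        rw [ht, hAcard] at this
        linarith
      exact le_of_mul_le_mul_left h' hcard0
    -- `G_x ⊆ fat_R(x)`, and the jump split
    have hGfat : μ.real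
        {ω | t ≤ ((A.filter fun y => ω ∈ openConnIn (↑(box 3 R) : Set (Site 3)) x y).card : ℝ)} ≤
        μ.real {ω | ∃ T : Finset (Site 3), Nat.sqrt (R ^ 3) ≤ T.card ∧
          ∀ y ∈ T, ω ∈ openConnIn (↑(box 3 R) : Set (Site 3)) x y} :=
      measureReal_mono fun ω hω => GiantScaleLRO.fat_of_count A hsqrt hω
    have hsplit := JumpSplit.measureReal_fat_le_giant_add_finiteTail (criticalProbI 3) hRn x
    have htail := hN R hNR
    linarith
  -- sum over `x ∈ Λ_m ⊆ Λ_R` and compare with B_∞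
  have hlow : ρ / 4 * ((box 3 m).card : ℝ) ≤ ∑ x ∈ box 3 R, μ.real
      {ω | (∃ T : Finset (Site 3), Nat.sqrt (R ^ 3) ≤ T.card ∧
          ∀ y ∈ T, ω ∈ openConnIn (↑(box 3 R) : Set (Site 3)) x y) ∧
        (openCluster ω x).Infinite} :=
    calc ρ / 4 * ((box 3 m).card : ℝ) = ∑ x ∈ box 3 m, ρ / 4 := by
          rw [Finset.sum_const, nsmul_eq_mul, mul_comm]
      _ ≤ ∑ x ∈ box 3 m, μ.real
          {ω | (∃ T : Finset (Site 3), Nat.sqrt (R ^ 3) ≤ T.card ∧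
              ∀ y ∈ T, ω ∈ openConnIn (↑(box 3 R) : Set (Site 3)) x y) ∧
            (openCluster ω x).Infinite} := Finset.sum_le_sum hfatinf
      _ ≤ _ := Finset.sum_le_sum_of_subset_of_nonneg (box_mono 3 hmR) fun _ _ _ => measureReal_nonneg
  have hup : ∑ x ∈ box 3 R, μ.real
      {ω | (∃ T : Finset (Site 3), Nat.sqrt (R ^ 3) ≤ T.card ∧
          ∀ y ∈ T, ω ∈ openConnIn (↑(box 3 R) : Set (Site 3)) x y) ∧
        (openCluster ω x).Infinite} ≤ max CB 0 * (R : ℝ) ^ ((3 : ℝ) - δ) :=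
    (hB R hR1).trans (mul_le_mul_of_nonneg_right (le_max_left _ _) (Real.rpow_nonneg hρR.le _))
  have hRm : (R : ℝ) = (((2 * ⌈(n : ℝ) ^ α⌉₊ : ℕ) : ℝ)) := by rw [hR, hm]
  rw [hRm] at hup
  rw [hcardm] at hlow
  have hm' : (m : ℝ) = ((⌈(n : ℝ) ^ α⌉₊ : ℕ) : ℝ) := by rw [hm]
  rw [hm'] at hlow
  linarith

/-- `PolyScaleLROOfTheta` (stmt-0858, every `α > 1`) gives `ScaleLRO(3/2)`. [folklore] -/
theorem scaleLRO_of_polyScaleLRO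
    (hP : Summit.CriticalPhenomena.PercolationContinuityZ3.Theses.PercFiniteBoxLRO.PolyScaleLROOfTheta) :
    ∃ α : ℝ, 1 ≤ α ∧ α < 2 ∧ ∀ p : unitInterval, 0 < theta (zdGraph 3) 0 p →
      ∃ ρ : ℝ, 0 < ρ ∧ ∀ n : ℕ, 1 ≤ n → ∀ x ∈ box 3 n, ∀ y ∈ box 3 n,
        ρ ≤ (bondPercolation (zdGraph 3) p).real
          (openConnIn (↑(box 3 ⌈(n : ℝ) ^ α⌉₊) : Set (Site 3)) x y) :=
  ⟨3 / 2, by norm_num, by norm_num, fun p hp => hP (3 / 2) (by norm_num) p hp⟩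

/-- p149769 as a corollary: **0858 ∧ B_∞ ⟹ θ(p_c) = 0** through `ScaleLRO(3/2)`. [folklore] -/
theorem percolationContinuityZ3_of_polyScaleLRO_of_giantFatMass'
    (hP : Summit.CriticalPhenomena.PercolationContinuityZ3.Theses.PercFiniteBoxLRO.PolyScaleLROOfTheta)
    (hB : ∃ δ C : ℝ, 0 < δ ∧ ∀ R : ℕ, 1 ≤ R →
      ∑ x ∈ box 3 R, (bondPercolation (zdGraph 3) (criticalProbI 3)).real
        {ω | (∃ T : Finset (Site 3), Nat.sqrt (R ^ 3) ≤ T.card ∧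
            ∀ y ∈ T, ω ∈ openConnIn (↑(box 3 R) : Set (Site 3)) x y) ∧
          (openCluster ω x).Infinite}
        ≤ C * (R : ℝ) ^ ((3 : ℝ) - δ)) :
    _root_.PercolationContinuityZ3 :=
  percolationContinuityZ3_of_scaleLRO_of_giantFatMass (scaleLRO_of_polyScaleLRO hP) hB

/-- **The crux alone is conjunct-strength modulo one scale of box LRO**:
`(∃ α ∈ [1,2), ScaleLRO(α)) → FreeBoxFatClusterMass → PercolationContinuityZ3` (crux ⟹ B_∞ by
`giantFatMass_of_freeBoxFatClusterMass`, p148583). [folklore] -/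
theorem percolationContinuityZ3_of_scaleLRO_of_freeBoxFatClusterMass
    (hX : ∃ α : ℝ, 1 ≤ α ∧ α < 2 ∧ ∀ p : unitInterval, 0 < theta (zdGraph 3) 0 p →
      ∃ ρ : ℝ, 0 < ρ ∧ ∀ n : ℕ, 1 ≤ n → ∀ x ∈ box 3 n, ∀ y ∈ box 3 n,
        ρ ≤ (bondPercolation (zdGraph 3) p).real
          (openConnIn (↑(box 3 ⌈(n : ℝ) ^ α⌉₊) : Set (Site 3)) x y))
    (h : Summit.CriticalPhenomena.PercolationContinuityZ3.Theses.PercBoundarySqueeze.FreeBoxFatClusterMass) :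
    _root_.PercolationContinuityZ3 :=
  percolationContinuityZ3_of_scaleLRO_of_giantFatMass hX (giantFatMass_of_freeBoxFatClusterMass h)

end Summit.CriticalPhenomena.PercolationContinuityZ3.FreeBoxFatClusterMassLine

end
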